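import Mathlib.Analysis.SpecialFunctions.Log.Basic
import Mathlib.Tactic.Linarith
import Mathlib.Tactic.Positivity
import Mathlib.Tactic.Ring
import HarnessLib

/-!
# `NoHeavyLowerTail` (stmt-CriticalPhenomena-4575) — the tree envelope TE: additive apex coordinates and cone closure (algebraic core)

Support file (prover seat `prim-ineq-gen-8`, gen 32; `--supports stmt-CriticalPhenomena-4575`; memo
`run/shared/lean/prim/prim-ineq-gen-8/FINDING-gen32-TE.md`).  Pure real algebra, no definitions, no named facts, no sorries.

CONTEXT.  For three vertices `a, b, c` of a finite weighted graph with cells `u0 = P(a|b|c)`, `uab = P(ab|c)`, `uac = P(ac|b)`,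
`ubc = P(a|bc)`, `u3 = P(abc)`, gen 29 (file `…APLGeometricClosure`) records that the apex 4-tuple
`(A_B, A_C, A_0, N_0) = (u0+uac, u0+uab, u0, σ(u0+ubc))/σ` is MULTIPLICATIVE over the pieces at `a`.  Gen 32 (memo above) works with the
three `σ`-free logarithmic coordinates
  `X = log(A_C/A_0) = log((u0+uab)/u0)`,  `Y = log(A_B/A_0) = log((u0+uac)/u0)`,  `Z = −log N_0 = −log(u0+ubc)`,
which are therefore ADDITIVE under piece-union, and shows that the closed hull of the forest instances is the convex cone
`TE = {Z ≤ F(X,Y)}`, `F(X,Y) = (Y−X)³/(Y²−X²−2XY·log(Y/X))` (superadditive, 1-homogeneous; `F(X,X) = 3X` is gen 31's profile row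
APL-P(sym), `F ≤ (3/2)(X+Y)` is APL-P).  This file records the two elementary algebraic facts behind "TE is closed under piece-union"
and "pendant scaling is subadditive in `Z`", in a form independent of the transcendental `F`:
* `APL.logCone_mul` — for ANY row function `F : ℝ → ℝ → ℝ` that is superadditive, the set of positive 4-tuples with
  `−log N_0 ≤ F(log(A_C/A_0), log(A_B/A_0))` is closed under coordinatewise products (piece-union at the apex); `APL.profile_mul`
  (gen 31) is the instance `F(x,y) = (3/2)(x+y)` after exponentiating;
* `APL.linearRow_add` — the additive form of every LINEAR majorant `κ·(X+Y)` of `F` (e.g. `κ = 3/2`, APL-P): sums of triples with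
  `z ≤ κ(x+y)` satisfy it (memo §3(b));
* `APL.scale_reach_subadd` — the `Z`-coordinate of a pendant-scaled union is at most the sum over the parts:
  `1 − z(1−(1−r)(1−r')) − (1−zr)(1−zr') = z(1−z) r r' ≥ 0` for `z ∈ [0,1]`, `r, r' ≥ 0` (memo §1, used in §3(c)), with the exact
  defect as `APL.scale_reach_defect`.  [this work]
-/

namespace Summit.CriticalPhenomena.PercolationContinuityZ3.Theorems

namespace APL

/-- **Cone closure under piece-union (abstract form).**  Let `F : ℝ → ℝ → ℝ` be superadditive
(`F x y + F x' y' ≤ F (x+x') (y+y')`).  If two positive apex 4-tuples `(aB, aC, a0, n)` and `(bB, bC, b0, m)` satisfy the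
logarithmic row `−log n ≤ F (log (aC/a0)) (log (aB/a0))` (resp. with `b`), then so does their coordinatewise product — the 4-tuple of a
union of pieces at the apex (gen 29 §1).  With `F` = the tree-envelope function of gen 32 this is "TE is closed under piece-union";
with `F(x,y) = (3/2)(x+y)` it is gen 31's `profile_mul`. [this work] -/
theorem logCone_mul (F : ℝ → ℝ → ℝ) (hF : ∀ x y x' y' : ℝ, F x y + F x' y' ≤ F (x + x') (y + y'))
    (aB aC a0 n bB bC b0 m : ℝ) (haB : 0 < aB) (haC : 0 < aC) (ha0 : 0 < a0) (hn : 0 < n)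
    (hbB : 0 < bB) (hbC : 0 < bC) (hb0 : 0 < b0) (hm : 0 < m)
    (ha : -Real.log n ≤ F (Real.log (aC / a0)) (Real.log (aB / a0)))
    (hb : -Real.log m ≤ F (Real.log (bC / b0)) (Real.log (bB / b0))) :
    -Real.log (n * m) ≤ F (Real.log ((aC * bC) / (a0 * b0))) (Real.log ((aB * bB) / (a0 * b0))) := by
  have e1 : (aC * bC) / (a0 * b0) = (aC / a0) * (bC / b0) := by
    field_simp
  have e2 : (aB * bB) / (a0 * b0) = (aB / a0) * (bB / b0) := by
    field_simp
  have hx : Real.log ((aC * bC) / (a0 * b0)) = Real.log (aC / a0) + Real.log (bC / b0) := by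
    rw [e1, Real.log_mul (ne_of_gt (div_pos haC ha0)) (ne_of_gt (div_pos hbC hb0))]
  have hy : Real.log ((aB * bB) / (a0 * b0)) = Real.log (aB / a0) + Real.log (bB / b0) := by
    rw [e2, Real.log_mul (ne_of_gt (div_pos haB ha0)) (ne_of_gt (div_pos hbB hb0))]
  have hz : Real.log (n * m) = Real.log n + Real.log m := Real.log_mul (ne_of_gt hn) (ne_of_gt hm)
  rw [hx, hy, hz]
  have hsup := hF (Real.log (aC / a0)) (Real.log (aB / a0)) (Real.log (bC / b0)) (Real.log (bB / b0))
  linarith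

/-- **Linear rows are additive.**  If `z ≤ κ (x + y)` and `z' ≤ κ (x' + y')` then `z + z' ≤ κ ((x+x') + (y+y'))`: every linear
majorant `κ·(X+Y)` of the envelope `F` (e.g. `κ = 3/2`, APL-P; `κ = g(θ₀) + …` tangent planes of the concave 1-homogeneous `F`)
defines a cone closed under the additive piece-union of gen 32 §1. [this work] -/
theorem linearRow_add (κ x y z x' y' z' : ℝ) (h : z ≤ κ * (x + y)) (h' : z' ≤ κ * (x' + y')) :
    z + z' ≤ κ * ((x + x') + (y + y')) := by
  have : κ * ((x + x') + (y + y')) = κ * (x + y) + κ * (x' + y') := by ring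
  rw [this]
  exact add_le_add h h'

/-- **Pendant scaling is subadditive in the reach coordinate `Z`.**  For a pendant apex edge of weight `z ∈ [0,1]` in front of a
union of two pieces with reach probabilities `r, r' ≥ 0`, the non-reach probability of the scaled union, `1 − z·(1 − (1−r)(1−r'))`,
exceeds the product `(1 − z r)(1 − z r')` of the scaled parts by exactly `z(1−z)·r·r' ≥ 0`; i.e. `Z(S_z(P+Q)) ≤ Z(S_z P) + Z(S_z Q)`
in the additive coordinates of gen 32 (memo §1, §3(c)). [this work] -/
theorem scale_reach_subadd (z r r' : ℝ) (hz0 : 0 ≤ z) (hz1 : z ≤ 1) (hr : 0 ≤ r) (hr' : 0 ≤ r') :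
    (1 - z * r) * (1 - z * r') ≤ 1 - z * (1 - (1 - r) * (1 - r')) := by
  have hid : 1 - z * (1 - (1 - r) * (1 - r')) - (1 - z * r) * (1 - z * r') = z * (1 - z) * (r * r') := by ring
  have hnn : 0 ≤ z * (1 - z) * (r * r') := by
    have h1 : 0 ≤ 1 - z := by linarith
    positivity
  linarith [hid, hnn]

/-- The exact defect in `scale_reach_subadd`: `1 − z(1−(1−r)(1−r')) − (1−zr)(1−zr') = z(1−z)·r·r'`. [this work] -/
theorem scale_reach_defect (z r r' : ℝ) :
    1 - z * (1 - (1 - r) * (1 - r')) - (1 - z * r) * (1 - z * r') = z * (1 - z) * (r * r') := by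
  ring

end APL

end Summit.CriticalPhenomena.PercolationContinuityZ3.Theorems
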